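import Literature.AlgebraicGeometry.Frobenioids.Categories
import Mathlib.CategoryTheory.Galois.Examples
import Mathlib.GroupTheory.GroupAction.Quotient
import Mathlib.GroupTheory.Index
import HarnessLib

/-!
# The base category `B(G)`: points, orbits, connected objects (finite continuous `G`-sets)

Mochizuki, *The geometry of Frobenioids I*, Kyushu J. Math. **62** (2008), §0 p. 13 ("`B(G)`", finite
sets with continuous `G`-action) and Remark 3.1.3 p. 58 (connected objects of a Galois category as the
typical base category) [cite: MochizukiFrdI2008, §0 p.13]; used by *Frobenioids II*, Example 1.4
pp. 12–13 (`Q₀ = B(Gal(F̃/F))⁰`, `P₀ = B(D_v)⁰`) [cite: MochizukiFrdII2008, Ex. 1.4 p.12].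
PROOF-ONLY toolkit (no definitions) for the tree's `BCat G = ContAction FintypeCat G` and the [FrdI] §0
notion `IsConnectedObj` (non-initial, not a coproduct of two non-initial objects): equivariance and
extensionality of morphisms; non-initial `⟺` has a point; `exists_smul_eq_of_isConnectedObj` (a
connected object is one `G`-orbit: else it is the coproduct in `B(G)` of an orbit and its stable
complement) and `isConnectedObj_of_transitive` (test against the two-point trivial object); maps into a
connected object are surjective, maps out of one are determined by one value; injective / surjective /
bijective `⟹` mono / epi / iso, mono `⟹` injective; `exists_coset_obj` (the coset object `G/U` of an
open subgroup of finite index: base point, transitivity, mapping property). `[IsTopologicalGroup G]` is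
assumed where objects are built (continuity = open stabilisers, `continuousSMul_iff_stabilizer_isOpen`).
-/

namespace Literature.AlgebraicGeometry.Frobenioids

namespace BCat

open CategoryTheory CategoryTheory.Limits
open scoped FintypeCatDiscrete

universe u

variable {G : Type u} [Group G] [TopologicalSpace G]

/-- Equivariance of a morphism of `B(G)`, pointwise. [cite: MochizukiFrdI2008, §0 p.13] -/
theorem hom_smul {X Y : BCat G} (f : X ⟶ Y) (g : G) (x : X.obj.V) :
    f.hom.hom (g • x) = g • f.hom.hom x := by
  have e := ConcreteCategory.congr_hom (f.hom.comm g) x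
  simp only [FintypeCat.comp_apply] at e
  exact e

/-- Morphisms of `B(G)` are determined by their underlying functions.
[cite: MochizukiFrdI2008, §0 p.13] -/
theorem hom_ext_apply {X Y : BCat G} {f f' : X ⟶ Y} (h : ∀ x, f.hom.hom x = f'.hom.hom x) :
    f = f' :=
  ObjectProperty.hom_ext _ (Action.hom_ext _ _ (FintypeCat.hom_ext _ _ h))

/-- Continuity of a finite `G`-set means: every stabiliser is open (Mathlib's
`continuousSMul_iff_stabilizer_isOpen`). [cite: MochizukiFrdI2008, §0 p.13] -/
theorem isContinuous_iff [IsTopologicalGroup G] (X : Action FintypeCat.{u} G) :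
    Action.IsContinuous X ↔ ∀ x : X.V, IsOpen (MulAction.stabilizer G x : Set G) := by
  constructor
  · intro h
    have h' : ContinuousSMul G X.V := h
    exact continuousSMul_iff_stabilizer_isOpen.mp h'
  · intro h
    have h' : ContinuousSMul G X.V := continuousSMul_iff_stabilizer_isOpen.mpr h
    exact h'

/-- Stabilisers of points of an object of `B(G)` are open. [cite: MochizukiFrdI2008, §0 p.13] -/
theorem isOpen_stabilizer (X : BCat G) (x : X.obj.V) :
    IsOpen (MulAction.stabilizer G x : Set G) := by
  have h' : ContinuousSMul G X.obj.V := X.property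
  exact stabilizer_isOpen G x

/-- Stabilisers of points of an object of `B(G)` have finite index (the orbit is finite).
[cite: MochizukiFrdI2008, §0 p.13] -/
theorem finiteIndex_stabilizer (X : BCat G) (x : X.obj.V) :
    (MulAction.stabilizer G x).FiniteIndex := by
  haveI : Finite (MulAction.orbit G x) := inferInstance
  haveI : Finite (G ⧸ MulAction.stabilizer G x) :=
    Finite.of_equiv _ (MulAction.orbitEquivQuotientStabilizer G x)
  exact Subgroup.finiteIndex_of_finite_quotient

/-- A finite `G`-set on which `G` acts trivially is continuous. [cite: MochizukiFrdI2008, §0 p.13] -/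
theorem isContinuous_of_smul_eq [IsTopologicalGroup G] (X : Action FintypeCat.{u} G)
    (h : ∀ (g : G) (x : X.V), g • x = x) : Action.IsContinuous X :=
  (isContinuous_iff X).mpr fun x => by
    convert isOpen_univ
    exact Set.eq_univ_of_forall fun g => MulAction.mem_stabilizer_iff.mpr (h g x)

/-! ### Non-initial objects are the objects with a point -/

/-- An object of `B(G)` without points is initial. [cite: MochizukiFrdI2008, §0 p.15] -/
theorem nonempty_isInitial_of_isEmpty (X : BCat G) (h : IsEmpty X.obj.V) :
    Nonempty (IsInitial X) :=
  ⟨IsInitial.ofUniqueHom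
    (fun _ => ObjectProperty.homMk
      { hom := FintypeCat.homMk fun x => (h.false x).elim
        comm := fun _ => FintypeCat.hom_ext _ _ fun x => (h.false x).elim })
    fun _ _ => hom_ext_apply fun x => (h.false x).elim⟩

/-- A non-initial object of `B(G)` has a point. [cite: MochizukiFrdI2008, §0 p.15] -/
theorem nonempty_of_isNonemptyObj (X : BCat G) (h : IsNonemptyObj X) : Nonempty X.obj.V := by
  by_contra h'
  rw [not_nonempty_iff] at h'
  exact h.false (nonempty_isInitial_of_isEmpty X h').some

/-- An object of `B(G)` with a point is non-initial (map it to the empty `G`-set).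
[cite: MochizukiFrdI2008, §0 p.15] -/
theorem isNonemptyObj_of_nonempty [IsTopologicalGroup G] (X : BCat G) (x : X.obj.V) :
    IsNonemptyObj X := by
  constructor
  intro hI
  let EA : Action FintypeCat.{u} G := { V := FintypeCat.of PEmpty.{u + 1}, ρ := 1 }
  have hE : Action.IsContinuous EA := (isContinuous_iff EA).mpr fun z => z.elim
  let E : BCat G := ⟨EA, hE⟩
  exact ((hI.to E).hom.hom x : PEmpty).elim

/-! ### Morphisms out of / into single orbits -/

/-- Two morphisms out of a transitive object that agree at one point are equal.
[cite: MochizukiFrdI2008, §0 p.13] -/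
theorem hom_eq_of_apply_eq_of_transitive {X Y : BCat G} (x₀ : X.obj.V)
    (htr : ∀ x : X.obj.V, ∃ g : G, g • x₀ = x) {f f' : X ⟶ Y}
    (h : f.hom.hom x₀ = f'.hom.hom x₀) : f = f' := by
  apply hom_ext_apply
  intro x
  obtain ⟨g, rfl⟩ := htr x
  rw [hom_smul, hom_smul, h]

/-- A morphism from an object with a point to a transitive object is surjective.
[cite: MochizukiFrdI2008, §0 p.13] -/
theorem surjective_of_transitive {X Y : BCat G} (f : X ⟶ Y) (x : X.obj.V) (y₀ : Y.obj.V)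
    (htr : ∀ y : Y.obj.V, ∃ g : G, g • y₀ = y) : Function.Surjective f.hom.hom := by
  intro y
  obtain ⟨g₁, hg₁⟩ := htr (f.hom.hom x)
  obtain ⟨g₂, hg₂⟩ := htr y
  refine ⟨(g₂ * g₁⁻¹) • x, ?_⟩
  rw [hom_smul, ← hg₁, smul_smul, inv_mul_cancel_right, hg₂]

/-- A morphism out of a transitive object is injective as soon as the stabiliser of the image of a
base point is contained in the stabiliser of the base point. [cite: MochizukiFrdI2008, §0 p.13] -/
theorem injective_of_stabilizer_le {X Y : BCat G} (f : X ⟶ Y) (x₀ : X.obj.V)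
    (htr : ∀ x : X.obj.V, ∃ g : G, g • x₀ = x)
    (h : MulAction.stabilizer G (f.hom.hom x₀) ≤ MulAction.stabilizer G x₀) :
    Function.Injective f.hom.hom := by
  intro x x' e
  obtain ⟨g, rfl⟩ := htr x
  obtain ⟨g', rfl⟩ := htr x'
  rw [hom_smul, hom_smul] at e
  have hmem : g⁻¹ * g' ∈ MulAction.stabilizer G (f.hom.hom x₀) := by
    rw [MulAction.mem_stabilizer_iff, mul_smul, ← e, inv_smul_smul]
  have := h hmem
  rw [MulAction.mem_stabilizer_iff, mul_smul, inv_smul_eq_iff] at this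
  exact this.symm

/-- An injective morphism of `B(G)` is a monomorphism. [cite: MochizukiFrdI2008, §0 p.13] -/
theorem mono_of_injective {X Y : BCat G} (f : X ⟶ Y) (hf : Function.Injective f.hom.hom) :
    Mono f :=
  ⟨fun g g' e => hom_ext_apply fun z => hf (by
    have := congrArg (fun k : _ ⟶ Y => k.hom.hom z) e
    simpa using this)⟩

/-- A surjective morphism of `B(G)` is an epimorphism. [cite: MochizukiFrdI2008, §0 p.13] -/
theorem epi_of_surjective {X Y : BCat G} (f : X ⟶ Y) (hf : Function.Surjective f.hom.hom) :
    Epi f :=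
  ⟨fun g g' e => hom_ext_apply fun y => by
    obtain ⟨x, rfl⟩ := hf y
    have := congrArg (fun k : X ⟶ _ => k.hom.hom x) e
    simpa using this⟩

/-- A bijective morphism of `B(G)` is an isomorphism. [cite: MochizukiFrdI2008, §0 p.13] -/
theorem isIso_of_bijective {X Y : BCat G} (f : X ⟶ Y) (hf : Function.Bijective f.hom.hom) :
    IsIso f := by
  haveI : IsIso f.hom.hom := (ConcreteCategory.isIso_iff_bijective f.hom.hom).mpr hf
  haveI : IsIso f.hom := isIso_of_reflects_iso f.hom (Action.forget FintypeCat G)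
  exact (ObjectProperty.isIso_hom_iff f).mp this

/-- An isomorphism of `B(G)` is bijective on points. [cite: MochizukiFrdI2008, §0 p.13] -/
theorem bijective_of_isIso {X Y : BCat G} (f : X ⟶ Y) [IsIso f] :
    Function.Bijective f.hom.hom := by
  haveI : IsIso f.hom := inferInstance
  haveI : IsIso f.hom.hom :=
    show IsIso ((Action.forget FintypeCat G).map f.hom) from inferInstance
  exact (ConcreteCategory.isIso_iff_bijective f.hom.hom).mp this

/-! ### Connected objects of `B(G)` are the single orbits -/

/-- A nonempty transitive object of `B(G)` is connected in the sense of [FrdI] §0: in a coproduct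
decomposition `X ≅ B₁ ⊔ B₂` with `B₁, B₂` non-initial, the induced map to the two-point trivial
`G`-set separating the summands would be constant. [cite: MochizukiFrdI2008, §0 p.15] -/
theorem isConnectedObj_of_transitive [IsTopologicalGroup G] (X : BCat G) (x₀ : X.obj.V)
    (htr : ∀ x : X.obj.V, ∃ g : G, g • x₀ = x) : IsConnectedObj X := by
  refine ⟨isNonemptyObj_of_nonempty X x₀, fun B₁ B₂ ι₁ ι₂ h₁ h₂ => ⟨fun hc => ?_⟩⟩
  obtain ⟨b₁⟩ := nonempty_of_isNonemptyObj B₁ h₁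
  obtain ⟨b₂⟩ := nonempty_of_isNonemptyObj B₂ h₂
  -- the two-point trivial `G`-set
  let ΩA : Action FintypeCat.{u} G := { V := FintypeCat.of (ULift.{u} Bool), ρ := 1 }
  have hΩ : Action.IsContinuous ΩA := isContinuous_of_smul_eq ΩA fun _ _ => rfl
  let Ω : BCat G := ⟨ΩA, hΩ⟩
  let c : ∀ (Y : BCat G), Bool → (Y ⟶ Ω) := fun Y t => ObjectProperty.homMk
    { hom := FintypeCat.homMk fun _ => ULift.up t
      comm := fun _ => FintypeCat.hom_ext _ _ fun _ => rfl }
  let u : X ⟶ Ω := hc.desc (BinaryCofan.mk (c B₁ false) (c B₂ true))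
  have hu₁ : ι₁ ≫ u = c B₁ false := hc.fac _ ⟨WalkingPair.left⟩
  have hu₂ : ι₂ ≫ u = c B₂ true := hc.fac _ ⟨WalkingPair.right⟩
  have hconst : ∀ x : X.obj.V, u.hom.hom x = u.hom.hom x₀ := fun x => by
    obtain ⟨g, rfl⟩ := htr x
    rw [hom_smul]
    rfl
  have e₁ : u.hom.hom (ι₁.hom.hom b₁) = ULift.up false :=
    congrArg (fun k : B₁ ⟶ Ω => k.hom.hom b₁) hu₁
  have e₂ : u.hom.hom (ι₂.hom.hom b₂) = ULift.up true :=
    congrArg (fun k : B₂ ⟶ Ω => k.hom.hom b₂) hu₂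
  rw [hconst] at e₁ e₂
  exact Bool.false_ne_true (ULift.up_injective (e₁.symm.trans e₂))

/-- A connected object of `B(G)` (in the sense of [FrdI] §0) is a single `G`-orbit: otherwise it is
the coproduct, in `B(G)`, of an orbit and its stable complement, both non-initial.
[cite: MochizukiFrdI2008, §0 p.15] -/
theorem exists_smul_eq_of_isConnectedObj [IsTopologicalGroup G] (X : BCat G)
    (hX : IsConnectedObj X) (x y : X.obj.V) : ∃ g : G, g • x = y := by
  classical
  by_contra hy
  -- `G`-stable subsets as objects of `B(G)`, with their inclusions
  let subA : ∀ (T : Set X.obj.V), (∀ (g : G) (z : X.obj.V), z ∈ T → g • z ∈ T) →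
      Action FintypeCat.{u} G := fun T hT =>
    { V := FintypeCat.of T
      ρ :=
        { toFun := fun g => FintypeCat.homMk fun z : T => (⟨g • z.1, hT g z.1 z.2⟩ : T)
          map_one' := FintypeCat.hom_ext _ _ fun z => Subtype.ext (one_smul G z.1)
          map_mul' := fun g h => FintypeCat.hom_ext _ _ fun z => Subtype.ext (mul_smul g h z.1) } }
  have subA_cont : ∀ T hT, Action.IsContinuous (subA T hT) := fun T hT =>
    (isContinuous_iff _).mpr fun z => by
      convert isOpen_stabilizer X z.1 using 1
      ext g
      simp only [SetLike.mem_coe, MulAction.mem_stabilizer_iff]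
      constructor
      · intro h
        exact congrArg Subtype.val h
      · intro h
        exact Subtype.ext h
  let sub : ∀ (T : Set X.obj.V), (∀ (g : G) (z : X.obj.V), z ∈ T → g • z ∈ T) → BCat G :=
    fun T hT => ⟨subA T hT, subA_cont T hT⟩
  let incl : ∀ T hT, sub T hT ⟶ X := fun T hT => ObjectProperty.homMk
    { hom := FintypeCat.homMk fun z : T => z.1
      comm := fun _ => FintypeCat.hom_ext _ _ fun _ => rfl }
  -- the orbit of `x` and its complement
  let S : Set X.obj.V := MulAction.orbit G x
  have hS : ∀ (g : G) (z : X.obj.V), z ∈ S → g • z ∈ S := fun g z hz => by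
    obtain ⟨g', rfl⟩ := MulAction.mem_orbit_iff.mp hz
    exact MulAction.mem_orbit_iff.mpr ⟨g * g', mul_smul g g' x⟩
  have hSc : ∀ (g : G) (z : X.obj.V), z ∈ Sᶜ → g • z ∈ Sᶜ := fun g z hz hgz => by
    apply hz
    obtain ⟨g', hg'⟩ := MulAction.mem_orbit_iff.mp hgz
    exact MulAction.mem_orbit_iff.mpr ⟨g⁻¹ * g', by rw [mul_smul, hg', inv_smul_smul]⟩
  have hxS : x ∈ S := MulAction.mem_orbit_self x
  have hyS : y ∈ Sᶜ := fun h => hy (MulAction.mem_orbit_iff.mp h)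
  -- `X` is the coproduct of the two
  let desc : ∀ (T : BCat G), (sub S hS ⟶ T) → (sub Sᶜ hSc ⟶ T) → (X ⟶ T) := fun T f g =>
    ObjectProperty.homMk
      { hom := FintypeCat.homMk fun z : X.obj.V =>
          if h : z ∈ S then f.hom.hom ⟨z, h⟩ else g.hom.hom ⟨z, h⟩
        comm := fun g₀ => FintypeCat.hom_ext _ _ fun z : X.obj.V => by
          change (if h : g₀ • z ∈ S then f.hom.hom ⟨g₀ • z, h⟩ else g.hom.hom ⟨g₀ • z, h⟩) =
            g₀ • (if h : z ∈ S then f.hom.hom ⟨z, h⟩ else g.hom.hom ⟨z, h⟩)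
          by_cases hz : z ∈ S
          · rw [dif_pos hz, dif_pos (hS g₀ z hz)]
            exact hom_smul f g₀ ⟨z, hz⟩
          · rw [dif_neg hz, dif_neg (hSc g₀ z hz)]
            exact hom_smul g g₀ ⟨z, hz⟩ }
  have desc_applyS : ∀ (T : BCat G) (f : sub S hS ⟶ T) (g : sub Sᶜ hSc ⟶ T) (z : X.obj.V)
      (hz : z ∈ S), (desc T f g).hom.hom z = f.hom.hom ⟨z, hz⟩ := fun T f g z hz => by
    change (if h : z ∈ S then f.hom.hom ⟨z, h⟩ else g.hom.hom ⟨z, h⟩) = _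
    rw [dif_pos hz]
  have desc_applySc : ∀ (T : BCat G) (f : sub S hS ⟶ T) (g : sub Sᶜ hSc ⟶ T) (z : X.obj.V)
      (hz : z ∈ Sᶜ), (desc T f g).hom.hom z = g.hom.hom ⟨z, hz⟩ := fun T f g z hz => by
    change (if h : z ∈ S then f.hom.hom ⟨z, h⟩ else g.hom.hom ⟨z, h⟩) = _
    rw [dif_neg (show z ∉ S from hz)]
  have hcolim : IsColimit (BinaryCofan.mk (incl S hS) (incl Sᶜ hSc)) :=
    BinaryCofan.IsColimit.mk _ (fun {T} f g => desc T f g)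
      (fun {T} f g => hom_ext_apply fun z : S => by
        change (desc T f g).hom.hom z.1 = f.hom.hom z
        rw [desc_applyS T f g z.1 z.2])
      (fun {T} f g => hom_ext_apply fun z : (Sᶜ : Set X.obj.V) => by
        change (desc T f g).hom.hom z.1 = g.hom.hom z
        rw [desc_applySc T f g z.1 z.2])
      (fun {T} f g m hm₁ hm₂ => by
        have h₁ : ∀ z : S, m.hom.hom (z.1 : X.obj.V) = f.hom.hom z := fun z =>
          congrArg (fun k : sub S hS ⟶ T => k.hom.hom z) hm₁
        have h₂ : ∀ z : (Sᶜ : Set X.obj.V), m.hom.hom (z.1 : X.obj.V) = g.hom.hom z := fun z =>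
          congrArg (fun k : sub Sᶜ hSc ⟶ T => k.hom.hom z) hm₂
        exact hom_ext_apply fun z : X.obj.V => by
          by_cases hz : z ∈ S
          · exact (h₁ ⟨z, hz⟩).trans (desc_applyS T f g z hz).symm
          · exact (h₂ ⟨z, hz⟩).trans (desc_applySc T f g z hz).symm)
  have hne₁ : IsNonemptyObj (sub S hS) := isNonemptyObj_of_nonempty _ (⟨x, hxS⟩ : S)
  have hne₂ : IsNonemptyObj (sub Sᶜ hSc) := isNonemptyObj_of_nonempty _ (⟨y, hyS⟩ : (Sᶜ : Set _))
  exact (hX.2 (sub S hS) (sub Sᶜ hSc) (incl S hS) (incl Sᶜ hSc) hne₁ hne₂).false hcolim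

/-- Connected objects of `B(G)` are exactly the nonempty single orbits.
[cite: MochizukiFrdI2008, §0 p.15] -/
theorem isConnectedObj_iff [IsTopologicalGroup G] (X : BCat G) :
    IsConnectedObj X ↔ ∃ x₀ : X.obj.V, ∀ x : X.obj.V, ∃ g : G, g • x₀ = x :=
  ⟨fun hX => (nonempty_of_isNonemptyObj X hX.1).elim fun x₀ =>
    ⟨x₀, fun x => exists_smul_eq_of_isConnectedObj X hX x₀ x⟩,
    fun ⟨x₀, htr⟩ => isConnectedObj_of_transitive X x₀ htr⟩

/-- Two morphisms out of a connected object of `B(G)` that agree at one point are equal.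
[cite: MochizukiFrdI2008, §0 p.15] -/
theorem hom_eq_of_apply_eq [IsTopologicalGroup G] {X Y : BCat G} (hX : IsConnectedObj X)
    {f f' : X ⟶ Y} (x₀ : X.obj.V) (h : f.hom.hom x₀ = f'.hom.hom x₀) : f = f' :=
  hom_eq_of_apply_eq_of_transitive x₀ (fun x => exists_smul_eq_of_isConnectedObj X hX x₀ x) h

/-- A morphism from an object with a point to a connected object of `B(G)` is surjective.
[cite: MochizukiFrdI2008, §0 p.15] -/
theorem surjective_of_isConnectedObj [IsTopologicalGroup G] {X Y : BCat G} (f : X ⟶ Y)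
    (x : X.obj.V) (hY : IsConnectedObj Y) : Function.Surjective f.hom.hom :=
  surjective_of_transitive f x (f.hom.hom x)
    (fun y => exists_smul_eq_of_isConnectedObj Y hY _ y)

/-- A morphism from a non-initial object to a connected object of `B(G)` is an epimorphism
("`B(G)⁰` is totally epimorphic"). [cite: MochizukiFrdI2008, §0 p.15] -/
theorem epi_of_isConnectedObj [IsTopologicalGroup G] {X Y : BCat G} (f : X ⟶ Y)
    (hX : IsNonemptyObj X) (hY : IsConnectedObj Y) : Epi f := by
  obtain ⟨x⟩ := nonempty_of_isNonemptyObj X hX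
  exact epi_of_surjective f (surjective_of_isConnectedObj f x hY)

/-! ### The coset objects `G/U` -/

/-- For an open subgroup `U ⊆ G` of finite index, the coset `G`-set `G/U` is an object of `B(G)`
with base point `q₀ = U` of stabiliser `U`; it is a single orbit, and for every object `X` and
point `x` with `U ⊆ Stab(x)` there is a morphism `G/U → X`, `gU ↦ g·x`.
[cite: MochizukiFrdI2008, §0 p.13] -/
theorem exists_coset_obj [IsTopologicalGroup G] (U : Subgroup G) (hU : IsOpen (U : Set G))
    [U.FiniteIndex] :
    ∃ (Q : BCat G) (q₀ : Q.obj.V), MulAction.stabilizer G q₀ = U ∧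
      (∀ q : Q.obj.V, ∃ g : G, g • q₀ = q) ∧
      ∀ (X : BCat G) (x : X.obj.V), U ≤ MulAction.stabilizer G x →
        ∃ b : Q ⟶ X, b.hom.hom q₀ = x := by
  have hQ : Action.IsContinuous (G ⧸ₐ U) := by
    rw [isContinuous_iff]
    intro q
    obtain ⟨g₀, hg₀⟩ := QuotientGroup.mk_surjective (q : G ⧸ U)
    have key : (MulAction.stabilizer G q : Set G) =
        (fun g : G => g₀⁻¹ * g * g₀) ⁻¹' (U : Set G) := by
      ext g
      simp only [SetLike.mem_coe, MulAction.mem_stabilizer_iff, Set.mem_preimage]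
      rw [← hg₀]
      change (g • (g₀ : G ⧸ U) : G ⧸ U) = (g₀ : G ⧸ U) ↔ _
      rw [MulAction.Quotient.smul_coe, smul_eq_mul, eq_comm, QuotientGroup.eq, mul_assoc]
    rw [key]
    exact hU.preimage (by fun_prop)
  have stab₀ : MulAction.stabilizer G ((((1 : G) : G ⧸ U)) : (G ⧸ₐ U).V) = U := by
    ext g
    rw [MulAction.mem_stabilizer_iff, MulAction.Quotient.smul_coe, smul_eq_mul, mul_one, eq_comm,
      QuotientGroup.eq, inv_one, one_mul]
  refine ⟨⟨G ⧸ₐ U, hQ⟩, (((1 : G) : G ⧸ U) : (G ⧸ₐ U).V), stab₀, ?_, ?_⟩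
  · intro q
    obtain ⟨g, hg⟩ := QuotientGroup.mk_surjective (q : G ⧸ U)
    refine ⟨g, ?_⟩
    rw [← hg]
    change (g • ((1 : G) : G ⧸ U) : G ⧸ U) = (g : G ⧸ U)
    rw [MulAction.Quotient.smul_coe, smul_eq_mul, mul_one]
  · intro X x hx
    refine ⟨ObjectProperty.homMk
      { hom := FintypeCat.homMk fun q : G ⧸ U =>
          Quotient.liftOn' q (fun g : G => g • x) fun g g' h => by
            have h' : g⁻¹ * g' ∈ U := QuotientGroup.leftRel_apply.mp h
            have := hx h'
            rw [MulAction.mem_stabilizer_iff, mul_smul, inv_smul_eq_iff] at this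
            exact this.symm
        comm := fun g₁ => by
          apply FintypeCat.hom_ext
          intro q
          obtain ⟨g, rfl⟩ := QuotientGroup.mk_surjective (q : G ⧸ U)
          simp only [FintypeCat.comp_apply, FintypeCat.homMk_apply]
          change Quotient.liftOn' (g₁ • (g : G ⧸ U) : G ⧸ U) _ _ = g₁ • (g • x)
          rw [MulAction.Quotient.smul_coe, smul_eq_mul]
          exact mul_smul g₁ g x }, ?_⟩
    exact one_smul G x

/-- A monomorphism of `B(G)` is injective on points (test against the coset object
`G/(Stab(x) ∩ Stab(x'))`). [cite: MochizukiFrdI2008, §0 p.13] -/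
theorem injective_of_mono [IsTopologicalGroup G] {X Y : BCat G} (f : X ⟶ Y) [Mono f] :
    Function.Injective f.hom.hom := by
  intro x x' e
  haveI := finiteIndex_stabilizer X x
  haveI := finiteIndex_stabilizer X x'
  obtain ⟨Q, q₀, hq₀, htr, hmap⟩ :=
    exists_coset_obj (MulAction.stabilizer G x ⊓ MulAction.stabilizer G x')
      ((isOpen_stabilizer X x).inter (isOpen_stabilizer X x'))
  obtain ⟨b, hb⟩ := hmap X x inf_le_left
  obtain ⟨b', hb'⟩ := hmap X x' inf_le_right
  have hbb' : b ≫ f = b' ≫ f :=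
    hom_eq_of_apply_eq_of_transitive q₀ htr (by
      change f.hom.hom (b.hom.hom q₀) = f.hom.hom (b'.hom.hom q₀)
      rw [hb, hb', e])
  have := congrArg (fun k : Q ⟶ X => k.hom.hom q₀) (cancel_mono f |>.mp hbb')
  simpa [hb, hb'] using this

end BCat

end Literature.AlgebraicGeometry.Frobenioids
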